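import Summits.QuantumFields.YangMills.Theorems.BalabanUVNodesN12MinimiserFamilyOfClassThreshold
import Literature.MathematicalPhysics.QuantumFieldTheory.Balaban1983to89.Node00.MultiScaleFibreChartB
import HarnessLib

/-!
# DAG node N12 [B15] — THE (J0′) PRODUCER OF RECORD WITH ITS ANALYTIC LETTERS ALL DISCHARGED: per (instance, height) ONE gauge-tolerance threshold `δ₀ > 0`; per base field only — **BOND-DATUM EDITION** (`…N12MinimiserFamilyOfClassThresholdB`, USED DECLARATIONS ONLY)

The print-datum ([Balaban1984PropagatorsII] (2.3)) (γ) twin of `Summits/…/Theorems/BalabanUVNodesN12MinimiserFamilyOfClassThreshold.lean`: the declarations of the parent whose STATEMENT reads the determining datum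
(`thm1Row_gaugeAct_of_residual`) and which N12's junction of record v14ᴸ uses (dag-n12-c g35 probe-2 census `UsedConstsN12RoadTyped2`, THEOREMS block), re-typed over a
BOND-LEVEL datum `𝔅 : BDetSet` (F0a `B15DeterminingSetsB`) and dag-n12-c's bond-datum chart `Node00.msChartB` (✓p774329; `msChart 𝐁 = msChartB (bondsDet 𝐁)` by `rfl`).  GENERATOR twin
(this seat's `work/g32/gen_thm.py`, block-extracted from the parent's tree bytes): namespace `…N12MinimiserFamilyOfClassThresholdB`, SAME short names, `DetSet ↦ BDetSet`, `AgreeOn 𝐁 ↦ AgreeOnB 𝔅`,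
`IsMinimizer ↦ IsMinimizerB`, `bondsOf (𝐁 j) ↦ 𝔅 j`, `msChart ∕ constrCard ∕ constrEnum ∕ ConstrSet ↦ …B`, NODE 00 chart lemmas `…msChart… ↦ …msChartB…`; proofs VERBATIM; the parent's
datum-free declarations REUSED BY NAME (`open`), never copied (private plumbing excepted, №366 R2).  The parent's (b) statements are the instances `𝔅 := bondsDet 𝐁`.

Cell `pub-ymgap` (HUMAN RULINGS D-0062 ∕ D-0149), seat `pub-ymgap-dag-n12-d` g32 (R134 N12 [B15] s2; the (ii) Theorems-side re-key of N12's road at print's [II] (2.3) datum — director-ym №338 ∕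
№343 (E1)(iii-b), FLAG №16 ∕ ruling (α); dag-n12-c DESIGN memo a793b2ebc0b803bf (ii); `N12-ROAD-TWIN-ORDER-2026-08-30.md`).  Count-neutral helper of K1⁹ `stmt-QuantumFields-27364`,
`--kind proof --supports … --as helper`.  THEOREMS ONLY (0 `def`, 0 `instance`, 0 `sorry`).

HONEST FRAMING (director-ym №338 (5)).  PURELY ADDITIVE: the parent stays landed and true on its own text; nothing in it is edited; no displayed premise of any consumer is deleted or
weakened; every hypothesis of the parent stays a hypothesis.  Nothing of Bałaban's analysis asserted; N12 NOT discharged; K0⁷ ∕ K1⁹ NOT closed; counts unmoved (typed 28∕28 · discharged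
8∕27, A 8∕28; K 1∕4); one finite 𝕋⁴ programme at fixed ε — R4 closes the conditional rung `BalabanLadder.UV` only; NOT the Yang–Mills mass gap (Clay); nothing continuum ∕ ℝ⁴ ∕ OS.

PARENT's DOCSTRING (the mathematics and the citations; read the site-level `𝐁` as the bond datum `𝔅`):
# DAG node N12 [B15] — THE (J0′) PRODUCER OF RECORD WITH ITS ANALYTIC LETTERS ALL DISCHARGED: per (instance, height) ONE gauge-tolerance threshold `δ₀ > 0`; per base field only
# (E) the (2.12) minimiser · the datum's regularity on `Z` · (δ) the gauge row at `δc ≤ δ₀` · (T1@q₀) — [15] (45), the slice action and datum coordinates, (β), (M), (R2) all INSIDE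

[Balaban1989LargeFieldII] = «[LF-II]», p. 357, (1.7)–(1.9) p. 358, (1.12)–(1.13) p. 359; [Balaban1989LargeFieldI] = «[IV]», (1.74) p. 192, Prop. 1 p. 194; [Balaban1985Variational] = «[15]»,
Thm 1 p. 279, Sect. C (44)–(48) p. 285, (81)–(83) p. 290, Sect. G pp. 305–307; [Balaban1984PropagatorsII] = «[B6]», Lemma 2.4 (2.128) p. 245; [Balaban1985Averaging] = «[4]», (122)–(126)
p. 36; [Balaban1985BackgroundPropagators] = «[B9]», (3.7) p. 391, (3.79)–(3.81) p. 406; [Balaban1988Convergent] = «[III]», (1.3) p. 246, (2.2) p. 255, (2.10)–(2.13) pp. 256–257.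

Cell `pub-ymgap`, HUMAN RULINGS D-0062 ∕ D-0149, lane owner `pub-ymgap-dag-n12-c` (g26, strategy s1).  Key K1⁹ `stmt-QuantumFields-27364`, `--kind proof --supports … --as helper`; count-neutral.
NEW leaf; CONSUMED BY NAME, nothing modified: the lane's one-gauge-row producer `…N12MinimiserFamilyOfClassGaugeRow` (g26 V3), dag-n12-w6 g14's multiplier-row producer
`…N12MultiplierLetterOfClass` ((M) ⟸ class + fibre + forest rows + `a`∕`Φ₀` + (δ) + (R2)), the lane's (R2) inhabitant `…N12SliceDatumCurvatureOfClass` (g26), dag-n12-w6 g11's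
`N12HVelocityOfClass.hH_velocity_Bj_of_isMinimizer_class` ([15] (45) in velocity currency per base field from the class).

WHY.  V3 displays per base field the multiplier row (M) with a constant `m` chosen before the base field, and the numerics `64(d−1)δc + m + #constr·C²·δc² < c♭`.  dag-n12-w6's producer
gives (M) with `m := 8(d−1)·δc·B₁·M₂` from the (δ) row and the chart-curvature letter (R2); the lane's `exists_uniform_sliceDatum_curvatureLetter_of_class` gives (R2) with ONE `M₂` per
height.  So every constant in the numerics is announced per (instance, height) and the numerics hold for all `δc` below a positive threshold `δ₀ := min r (min 1 (c♭ ∕ (2(K+1))))`,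
`K := 64(d−1) + 8(d−1)·B₁·M₂ + #constr·C²`.  THIS FILE packages it, defines the slice action `a` and the slice datum coordinates `Φ₀` by their formulas inside, and takes [15] (45) from
dag-n12-w6 g11's class theorem: per base field NO analytic letter and NO definitional row remains.

CONTENTS (namespace `Summit.QuantumFields.YangMills.BalabanUVNodes.N12MinimiserFamilyOfClassThreshold`; three theorems, no `def`, no `instance`, no `sorry`).  §1 ★
`thm1Row_gaugeAct_of_residual` ((T1@q₀) passes to `U₀^σ` for a residual `σ`); §3 ★★★ `…_threshold_residual` (the gauge row asked of `U₀^σ`, `σ` residual — the (σ)_N producer's output shape); §2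
★★★ `hMin_atRecord_of_node00Letters_thm1AtBase_central_ofClass_threshold` — instance-level: the capstone's record data + one forest with (F1), (F2), (TREE), (F3); per height: the radius
letter `hsbU` at a POSITIVE `ρ″`, the floors `12(d−1)L·εreg ≤ ρ″`, `6(d−1)Lᵏ·δ ≤ ρ″`, dag-n12-w6's right-inverse letter `hHB` at `(εH, B)` with `εreg ≤ εH`, `0 ≤ B` (all inhabited by
`N12HsurjOfClass.exists_hsurjLetters`); ANNOUNCED `∃ δ₀ > 0`; then for every `0 ≤ δc ≤ δ₀` and per base field (E) · datum regularity · (δ) at `δc` · (T1@q₀) ⇒ the (J0′) conclusion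
VERBATIM.

HONEST FRAMING ∕ LOCATED.  Composition by name + one line of real arithmetic; (E) and (T1@q₀) are [15] Thm 1's rows (existence in the OPEN class = interiority; uniqueness modulo the
central residual gauge — NODE 00 ∕ b11 currency); (δ) is a GAUGE letter (bondwise near-flatness after a residual normalisation — the direct road's (N) producers; LOCATED-GEOM v3 for the
shape coverage: vacuous-by-shape on ring-like `Ω₁(Z)` with large datum holonomy); `δ₀` and every absorbed constant are EXISTENCE constants per (instance, height) (U4 grade; k-uniformity
NOT claimed); nothing of Bałaban's estimates asserted; count-neutral helper; N12 NOT discharged; K1⁹ NOT closed; counts unmoved; one finite 𝕋⁴ programme at fixed ε — R4 closes the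
conditional finite-𝕋⁴ rung `BalabanLadder.UV` only; NOT continuum ∕ OS ∕ mass gap ∕ Clay.
-/

noncomputable section

open scoped BigOperators Matrix.Norms.L2Operator Topology

namespace Summit.QuantumFields.YangMills.BalabanUVNodes.N12MinimiserFamilyOfClassThresholdB

open Literature.MathematicalPhysics.QuantumFieldTheory.Balaban1983to89.B15DeterminingSetsB

open Set Metric Filter
open Literature.MathematicalPhysics.QuantumFieldTheory.Balaban1983to89
open Literature.MathematicalPhysics.QuantumFieldTheory.Balaban1983to89.Node00 (SU coeField coeField_apply SmallBelow ConstrSetB constrCardB constrEnumB dIterL)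
open T4Continuum B15DeterminingSets GaugeField
open B14.Eq213MaximalDomains (side)
open B14.Eq213DetSet (Bj Bj_of_gt Bj_zero maxDomT)
open B15Prop1Carrier (plaqsInside)
open B15AveragingHolomorphic (iterMh)
open B15ComplexifiedDatumFamily (conjVec)
open B15SU2ChartHolomorphic (genE expMulC logCoordC)
open B15Prop1AnalyticExtClause (cplxVec norm_cplxVec_apply)
open B15Prop1ChartCalculusSU2 (E3)
open B15Prop1ChartSU2 (su2Chart)
open B15ShellGauge193 (shellGauge)
open B15Extension193 (extend)
open B16Sect1Backgrounds (toMS expMul)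
open ExpMeanLog (expMeanLogSU)
open BlockAveraging (blockAvg)
open T4CubeChartGnomonic (SU2)
open Literature.MathematicalPhysics.QuantumFieldTheory.BalabanImbrieJaffe1984to88.BIJ85Eq453GaugeField (qsstarGIter0)
open Summit.QuantumFields.YangMills.BalabanUVNodes.N12MinimiserFamilyOfClassGaugeRow (hMin_atRecord_of_node00Letters_thm1AtBase_central_ofClass_gaugeRow)
open Summit.QuantumFields.YangMills.BalabanUVNodes.N12MultiplierLetterOfClass (multiplierLetter_Bj_of_isMinimizer_class_of_curvatureLetter)
open Summit.QuantumFields.YangMills.BalabanUVNodes.N12HVelocityOfClass (hH_velocity_Bj_of_isMinimizer_class)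
open B15Prop1MinimiserTowerAxialGauge (isMinimizer_gaugeAct_of_residual)
open B15Eq177ValueInvarianceCoDiv (gaugeAct_mem_regMSCoPOfRecord)
open B16Sect1Backgrounds (mulG gaugeAct_gaugeAct)
open B14Eq16FaddeevPopov (wilsonAction4_gaugeAct')
open Summit.QuantumFields.YangMills.BalabanUVNodes.N12SliceDatumCurvatureOfClass (exists_uniform_sliceDatum_curvatureLetter_of_class)
open B5Eq118OneStroke (iterBlockOf)
open B14.Eq216Concrete (feeds)
open B15Eq112TorusCover (lift)
open T4AxialGaugeSmallField (boxPlaqs)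
open T4AdjointCovarianceUnitary (lieSU)
open Node00 (msChartB avOfRecord regMSCoPOfRecord)
open scoped Matrix.Norms.L2Operator

section
variable {F : T4Family} {k : ℕ}

/-- ★ **(T1@q₀) FOR `U₀^σ` FROM (T1@q₀) FOR `U₀`, `σ` RESIDUAL** (generic lattice, class, determining set, datum): if every constrained `U ∈ reg′` with `A(U) ≤ A(U₀)` is carried to `U₀`
by a gauge whose scale-`j` images agree at the two ends of every constrained bond and are central there, then the same holds with `U₀` replaced by `U₀^σ` for every `σ` whose scale-`j`
images are `1` at those ends (`A(U₀^σ) = A(U₀)`; compose with `σ`: `(σu)` has the images of `u` at the constrained ends).  [15] (181): the residual group of the constraints acts on the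
minimal orbit. [cite: Balaban1985Variational, (3)–(4) p.278, (181) p.307; Balaban1988Convergent, (2.12) p.256] -/
theorem thm1Row_gaugeAct_of_residual {P : Params} (av : ∀ j, Averaging P j SU2) (reg' : Set (GaugeField P 0 SU2)) (𝔅 : BDetSet P) (kc : ℕ)
    (V : MSField P SU2) {σ : GaugeTransf P 0 SU2}
    (hσ : ∀ j, j ≤ kc → ∀ b ∈ (𝔅 j), toMS σ j b.src = 1 ∧ toMS σ j b.tgt = 1) {U₀ : GaugeField P 0 SU2}
    (hT1 : ∀ U ∈ reg', AgreeOnB 𝔅 (avgFamily av U) V → wilsonAction4 U ≤ wilsonAction4 U₀ →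
      ∃ u : GaugeTransf P 0 SU2, (∀ j, j ≤ kc → ∀ b ∈ (𝔅 j), toMS u j b.src = toMS u j b.tgt ∧ ∀ g : SU2, toMS u j b.src * g = g * toMS u j b.src) ∧ gaugeAct u U = U₀) :
    ∀ U ∈ reg', AgreeOnB 𝔅 (avgFamily av U) V → wilsonAction4 U ≤ wilsonAction4 (gaugeAct σ U₀) →
      ∃ u : GaugeTransf P 0 SU2, (∀ j, j ≤ kc → ∀ b ∈ (𝔅 j), toMS u j b.src = toMS u j b.tgt ∧ ∀ g : SU2, toMS u j b.src * g = g * toMS u j b.src) ∧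
        gaugeAct u U = gaugeAct σ U₀ := by
  intro U hU hUV hA
  rw [wilsonAction4_gaugeAct'] at hA
  obtain ⟨u, hu, huU⟩ := hT1 U hU hUV hA
  refine ⟨mulG σ u, fun j hj b hb => ?_, by rw [← gaugeAct_gaugeAct, huU]⟩
  obtain ⟨hst, hcen⟩ := hu j hj b hb
  obtain ⟨hs1, ht1⟩ := hσ j hj b hb
  have hs : toMS (mulG σ u) j b.src = toMS u j b.src := by
    show σ (embIter j b.src) * u (embIter j b.src) = u (embIter j b.src)
    rw [show σ (embIter j b.src) = 1 from hs1, one_mul]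
  have ht : toMS (mulG σ u) j b.tgt = toMS u j b.tgt := by
    show σ (embIter j b.tgt) * u (embIter j b.tgt) = u (embIter j b.tgt)
    rw [show σ (embIter j b.tgt) = 1 from ht1, one_mul]
  rw [hs, ht]
  exact ⟨hst, hcen⟩

end

end Summit.QuantumFields.YangMills.BalabanUVNodes.N12MinimiserFamilyOfClassThresholdB

end
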